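import Mathlib
import Summits.NavierStokesRegularity.NavierStokesRegularity.Theorems.EulerZoomLiouvillePowerGaugeEulerLiouvilleSelfSimilarPressureParking
import HarnessLib

/-!
# THE CAPACITY LAYER OF THE PRESSURISED SET, kernel half — the NEWTONIAN form of the mean-value defect of the profile pressure
# (crux `EulerZoomLiouville.PowerGaugeEulerLiouville` = stmt-NavierStokesRegularity-19832, THE ONE STATEMENT, T2 face «pressurised stagnant tubes»;
#  LEAD ns-typeII-p2 g12 RESIDUE-MEMO-19832-g12 §5/§7 «missing: a capacity estimate»; line `needle_faces` stub B; width seat ns-ezl-w1 g5)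

Route №10 `EulerZoomLiouville` (NavierStokesRegularity).  Sequel of `…SelfSimilarPressureParking` (g4, the two-scale `sup` form).  The `s`-form of the
sub-mean-value defect (`Literature/…/SubMeanValue`: `η(x₀) ≤ ∫ χ_R η(x₀+·) + ∫₀¹ s ∫ Q(y) f(x₀ + s y) dy ds`, `0 ≤ Q ≤ B` off `‖y‖ < 2R`, `Δη ≥ −f`;
the kernel form is «left to the consumers» there) is turned into its KERNEL (Newtonian) form by the substitution `z = s y` and Tonelli:

* `integrableOn_inv_norm_ball`, `setIntegral_inv_norm_ball` (`∫_{B_r(0)} ‖x‖⁻¹ dx = (3/2) v₁ r²` on `ℝ³`, `v₁ = vol B₁`), translated twins, and the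
  integrability of `f · ‖· − z‖⁻¹` on balls for continuous `f`;
* `mul_integral_mul_comp_add_smul_eq` (`s ∫ Q(y) f(x₀+sy) dy = ∫ s⁻² Q(z/s) f(x₀+z) dz`), `setIntegral_kernel_le` (the kernel `∫_{(0,1]} s⁻² Q(z/s) ds`
  vanishes for `s ≤ ‖z‖/(2R)` and is `≤ B(2R/‖z‖ − 1)`);
* **`defect_le_potential`** — `∫₀¹ s ∫ Q(y) f(x₀ + s y) dy ds ≤ 2BR ∫_{B_{2R}(x₀)} f(z) ‖z − x₀‖⁻¹ dz`;
* **`pressure_excess_le_potential`** — ANY `C²` self-similar Euler profile `(V, P′)` on `ℝ³` (any `γ`, any centre), `R > 0`: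
  `P′(x₀) ≤ ∫ χ_R(y) P′(x₀+y) dy + (12/m) ∫_{B_{2R}(x₀)} ‖DV(z)‖² ‖z − x₀‖⁻¹ dz` (`m = baseBumpMass`; `ΔP′ ≥ −3‖DV‖²`): the pressure excess at a
  point is carried by the truncated NEWTONIAN POTENTIAL OF THE ENSTROPHY at that point (all scales at once, vs. the two-scale `sup` form of g4).

The dual-capacity bound and its volume instance are in `…SelfSimilarPressureCapacity`.
HONEST LABEL: tool; nothing here excludes a needle.  WHAT THIS IS NOT: not NS, not E — `--supports` stmt-19832 on the MODEL lattice; 19832 OPEN;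
NS regularity NOT proved. [folklore; GilbargTrudinger2001 Thm 2.1 (Green representation); ConstantinIgnatovaVicol2026Putative §3.1.1 (3.3)]
-/

noncomputable section

-- flat `Theorems/<Route><Decl>…` files of one crux share the namespace of the crux (tree convention)
set_option linter.dupNamespace false

open MeasureTheory Set Filter Topology Metric Function InnerProductSpace
open scoped RealInnerProductSpace NNReal ENNReal Laplacian

namespace Summit.NavierStokesRegularity.NavierStokesRegularity.Theorems.PowerGaugeEulerLiouville.PressureParking

open Literature.Analysis Literature.Analysis.FluidPDE

/-! ### The kernel `‖x‖⁻¹` on balls of `ℝ³` -/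

/-- `x ↦ ‖x‖⁻¹` is integrable on every ball of `ℝ³` centred at `0` (polar coordinates: `r² · r⁻¹ = r`). [folklore] -/
theorem integrableOn_inv_norm_ball (R : ℝ) :
    IntegrableOn (fun x : EuclideanSpace ℝ (Fin 3) => ‖x‖⁻¹) (ball (0 : EuclideanSpace ℝ (Fin 3)) R) := by
  have h := (integrableOn_fun_norm_addHaar (volume : Measure (EuclideanSpace ℝ (Fin 3))) (f := fun y : ℝ => y⁻¹)
    (r := R)).2
  rw [finrank_euclideanSpace_fin] at h
  apply h
  have heq : EqOn (fun y : ℝ => y ^ (3 - 1) • y⁻¹) (fun y => y) (Ioo 0 R) := fun y hy => by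
    have hy0 : y ≠ 0 := hy.1.ne'
    simp only [smul_eq_mul]
    field_simp
  rw [integrableOn_congr_fun heq measurableSet_Ioo]
  exact (continuous_id.integrableOn_Icc (a := 0) (b := R)).mono_set Ioo_subset_Icc_self

/-- `∫_{B_r(0)} ‖x‖⁻¹ dx = (3/2) v₁ r²` on `ℝ³` (`v₁ = vol B₁`; radial integration `3 v₁ ∫₀^r y dy`). [folklore] -/
theorem setIntegral_inv_norm_ball {r : ℝ} (hr : 0 < r) :
    ∫ x in ball (0 : EuclideanSpace ℝ (Fin 3)) r, ‖x‖⁻¹ =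
      3 / 2 * (volume (ball (0 : EuclideanSpace ℝ (Fin 3)) 1)).toReal * r ^ 2 := by
  set g : ℝ → ℝ := (Iio r).indicator fun y => y⁻¹ with hgdef
  have hind : (ball (0 : EuclideanSpace ℝ (Fin 3)) r).indicator (fun x => ‖x‖⁻¹) = fun x => g ‖x‖ := by
    funext x
    by_cases hx : ‖x‖ < r
    · rw [indicator_of_mem (mem_ball_zero_iff.2 hx), hgdef, indicator_of_mem (mem_Iio.2 hx)]
    · rw [indicator_of_notMem (by rwa [mem_ball_zero_iff]), hgdef, indicator_of_notMem (by rwa [mem_Iio])]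
  rw [← integral_indicator measurableSet_ball, hind, integral_fun_norm_addHaar volume g, finrank_euclideanSpace_fin]
  have hint : (∫ y in Ioi (0 : ℝ), y ^ (3 - 1) • g y) = ∫ y in Ioc (0 : ℝ) r, y := by
    have h1 : (fun y : ℝ => y ^ (3 - 1) • g y) = (Iio r).indicator fun y => y ^ 2 * y⁻¹ := by
      funext y
      by_cases hy : y < r
      · rw [hgdef, indicator_of_mem (mem_Iio.2 hy), indicator_of_mem (mem_Iio.2 hy), smul_eq_mul]
      · rw [hgdef, indicator_of_notMem (by rwa [mem_Iio]), indicator_of_notMem (by rwa [mem_Iio]), smul_zero]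
    rw [h1, setIntegral_indicator measurableSet_Iio, show Ioi (0 : ℝ) ∩ Iio r = Ioo 0 r from rfl,
      ← integral_Ioc_eq_integral_Ioo]
    refine setIntegral_congr_fun measurableSet_Ioc fun y hy => ?_
    have hy0 : y ≠ 0 := hy.1.ne'
    field_simp
  rw [hint, ← intervalIntegral.integral_of_le hr.le, integral_id, measureReal_def]
  simp only [nsmul_eq_mul, smul_eq_mul, Nat.cast_ofNat]
  ring

/-- The translated kernel `x ↦ ‖x − z‖⁻¹` is integrable on every ball of `ℝ³`. [folklore] -/
theorem integrableOn_inv_norm_sub_ball (z x₀ : EuclideanSpace ℝ (Fin 3)) (R : ℝ) :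
    IntegrableOn (fun x : EuclideanSpace ℝ (Fin 3) => ‖x - z‖⁻¹) (ball x₀ R) := by
  -- `ball x₀ R ⊆ ball z (R + ‖x₀ - z‖) = z + ball 0 (R + ‖x₀ - z‖)`
  have h0 := integrableOn_inv_norm_ball (R + dist x₀ z)
  have h1 : IntegrableOn (fun x : EuclideanSpace ℝ (Fin 3) => ‖x - z‖⁻¹) (ball z (R + dist x₀ z)) := by
    have h := (h0.integrable_indicator measurableSet_ball).comp_sub_right z
    have heq : (fun x : EuclideanSpace ℝ (Fin 3) => (ball (0 : EuclideanSpace ℝ (Fin 3)) (R + dist x₀ z)).indicator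
        (fun x => ‖x‖⁻¹) (x - z)) = (ball z (R + dist x₀ z)).indicator fun x => ‖x - z‖⁻¹ := by
      funext x
      by_cases hx : x ∈ ball z (R + dist x₀ z)
      · rw [indicator_of_mem hx, indicator_of_mem (by rwa [mem_ball_zero_iff, ← dist_eq_norm])]
      · rw [indicator_of_notMem hx, indicator_of_notMem (by rwa [mem_ball_zero_iff, ← dist_eq_norm])]
    rw [heq] at h
    exact (integrable_indicator_iff measurableSet_ball).1 h
  exact h1.mono_set fun x hx => by
    rw [mem_ball] at hx ⊢
    linarith [dist_triangle x x₀ z]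

/-- `f · ‖· − z‖⁻¹` is integrable on balls for continuous `f`. [folklore] -/
theorem integrableOn_mul_inv_norm_sub_ball {f : EuclideanSpace ℝ (Fin 3) → ℝ} (hf : Continuous f)
    (z x₀ : EuclideanSpace ℝ (Fin 3)) (R : ℝ) :
    IntegrableOn (fun x : EuclideanSpace ℝ (Fin 3) => f x * ‖x - z‖⁻¹) (ball x₀ R) := by
  obtain ⟨C, hC⟩ := (isCompact_closedBall x₀ R).exists_bound_of_continuousOn hf.continuousOn
  refine Integrable.bdd_mul (c := C) (integrableOn_inv_norm_sub_ball z x₀ R) hf.aestronglyMeasurable ?_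
  exact (ae_restrict_iff' measurableSet_ball).2 (Eventually.of_forall fun x hx => hC x (ball_subset_closedBall hx))

/-- `∫_{B_r(z)} ‖x − z‖⁻¹ dx = (3/2) v₁ r²`. [folklore] -/
theorem setIntegral_inv_norm_sub_ball {r : ℝ} (hr : 0 < r) (z : EuclideanSpace ℝ (Fin 3)) :
    ∫ x in ball z r, ‖x - z‖⁻¹ = 3 / 2 * (volume (ball (0 : EuclideanSpace ℝ (Fin 3)) 1)).toReal * r ^ 2 := by
  rw [← setIntegral_inv_norm_ball hr, ← setIntegral_ball_comp_add (fun x => ‖x - z‖⁻¹) z r]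
  simp

/-! ### Kernel form of the mean value defect -/

section Kernel

variable {Q f : EuclideanSpace ℝ (Fin 3) → ℝ} {B R : ℝ} {x₀ : EuclideanSpace ℝ (Fin 3)}

/-- The substitution `z = s y` (`s > 0`): `s ∫ Q(y) f(x₀ + s y) dy = ∫ s⁻² Q(z/s) f(x₀ + z) dz` on `ℝ³` (`Measure.integral_comp_smul`). [folklore] -/
theorem mul_integral_mul_comp_add_smul_eq (Q f : EuclideanSpace ℝ (Fin 3) → ℝ) (x₀ : EuclideanSpace ℝ (Fin 3)) {s : ℝ} (hs : 0 < s) :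
    s * ∫ y, Q y * f (x₀ + s • y) = ∫ z, (s ^ 2)⁻¹ * (Q (s⁻¹ • z) * f (x₀ + z)) := by
  set g : EuclideanSpace ℝ (Fin 3) → ℝ := fun z => Q (s⁻¹ • z) * f (x₀ + z) with hgdef
  have hg : (fun y => Q y * f (x₀ + s • y)) = fun y => g (s • y) := by
    funext y
    simp only [hgdef, inv_smul_smul₀ hs.ne']
  have hsub := Measure.integral_comp_smul volume g s
  rw [finrank_euclideanSpace_fin, abs_of_nonneg (by positivity : (0 : ℝ) ≤ (s ^ 3)⁻¹), smul_eq_mul] at hsub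
  rw [hg, hsub, integral_const_mul, ← mul_assoc]
  congr 1
  field_simp

/-- **The kernel.**  For `0 ≤ Q ≤ B` continuous vanishing off `‖y‖ < 2R`, `c ≥ 0` and `z ≠ 0`:
`∫_{(0,1]} s⁻² Q(z/s) c ds ≤ 𝟙_{B_{2R}}(z) · 2BR · c ‖z‖⁻¹` — the integrand vanishes for `s ≤ ‖z‖/(2R)` and is `≤ B c s⁻²` beyond. [folklore] -/
theorem setIntegral_kernel_le (hQ0 : ∀ y, 0 ≤ Q y) (hQB : ∀ y, Q y ≤ B) (hR : 0 < R)
    (hQz : ∀ y, 2 * R ≤ ‖y‖ → Q y = 0) {z : EuclideanSpace ℝ (Fin 3)} (hz : z ≠ 0) {c : ℝ} (hc : 0 ≤ c) :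
    ∫ s in Ioc (0 : ℝ) 1, (s ^ 2)⁻¹ * (Q (s⁻¹ • z) * c) ≤
      (ball (0 : EuclideanSpace ℝ (Fin 3)) (2 * R)).indicator (fun z => 2 * B * R * (c * ‖z‖⁻¹)) z := by
  have hB0 : 0 ≤ B := (hQ0 0).trans (hQB 0)
  have hzn : 0 < ‖z‖ := norm_pos_iff.2 hz
  have hnorm : ∀ s : ℝ, 0 < s → ‖s⁻¹ • z‖ = ‖z‖ / s := fun s hs => by
    rw [norm_smul, norm_inv, Real.norm_eq_abs, abs_of_pos hs, div_eq_inv_mul]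
  by_cases hzR : ‖z‖ < 2 * R
  · -- inside the ball: split at `s₀ = ‖z‖/(2R)`
    rw [indicator_of_mem (mem_ball_zero_iff.2 hzR)]
    set s₀ : ℝ := ‖z‖ / (2 * R) with hs₀def
    have hs₀ : 0 < s₀ := by positivity
    have hs₀1 : s₀ < 1 := (div_lt_one (by positivity)).2 hzR
    set h : ℝ → ℝ := fun s => B * c * (s ^ 2)⁻¹ with hhdef
    have hhc : ContinuousOn h (Icc s₀ 1) := by
      refine continuousOn_const.mul ((continuousOn_pow 2).inv₀ fun s hs => ?_)
      exact pow_ne_zero 2 (hs₀.trans_le hs.1).ne'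
    have hhi : IntegrableOn h (Ioc s₀ 1) := (hhc.integrableOn_compact isCompact_Icc).mono_set Ioc_subset_Icc_self
    have hind : Integrable ((Ioc s₀ 1).indicator h) (volume.restrict (Ioc (0 : ℝ) 1)) :=
      (hhi.integrable_indicator measurableSet_Ioc).integrableOn
    have hle : ∫ s in Ioc (0 : ℝ) 1, (s ^ 2)⁻¹ * (Q (s⁻¹ • z) * c) ≤ ∫ s in Ioc (0 : ℝ) 1, (Ioc s₀ 1).indicator h s := by
      refine integral_mono_of_nonneg (Eventually.of_forall fun s => ?_) hind ?_
      · exact mul_nonneg (inv_nonneg.2 (sq_nonneg _)) (mul_nonneg (hQ0 _) hc)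
      · refine (ae_restrict_iff' measurableSet_Ioc).2 (Eventually.of_forall fun s hs => ?_)
        show (s ^ 2)⁻¹ * (Q (s⁻¹ • z) * c) ≤ (Ioc s₀ 1).indicator h s
        by_cases hss : s ≤ s₀
        · have hfar : 2 * R ≤ ‖s⁻¹ • z‖ := by
            rw [hnorm s hs.1, le_div_iff₀ hs.1]
            calc 2 * R * s ≤ 2 * R * s₀ := by gcongr
              _ = ‖z‖ := by rw [hs₀def]; field_simp
          rw [hQz _ hfar, zero_mul, mul_zero]
          exact indicator_nonneg (fun t _ => by rw [hhdef]; positivity) _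
        · have hmem : s ∈ Ioc s₀ 1 := ⟨not_le.1 hss, hs.2⟩
          rw [indicator_of_mem hmem, hhdef]
          have h1 : Q (s⁻¹ • z) * c ≤ B * c := mul_le_mul_of_nonneg_right (hQB _) hc
          calc (s ^ 2)⁻¹ * (Q (s⁻¹ • z) * c) ≤ (s ^ 2)⁻¹ * (B * c) :=
                mul_le_mul_of_nonneg_left h1 (inv_nonneg.2 (sq_nonneg _))
            _ = B * c * (s ^ 2)⁻¹ := by ring
    have heval : ∫ s in Ioc (0 : ℝ) 1, (Ioc s₀ 1).indicator h s = B * c * (s₀⁻¹ - 1) := by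
      rw [setIntegral_indicator measurableSet_Ioc,
        show Ioc (0 : ℝ) 1 ∩ Ioc s₀ 1 = Ioc s₀ 1 from inter_eq_right.2 (Ioc_subset_Ioc hs₀.le le_rfl),
        ← intervalIntegral.integral_of_le hs₀1.le, hhdef, intervalIntegral.integral_const_mul]
      have hderiv : ∀ s ∈ uIcc s₀ 1, HasDerivAt (fun s : ℝ => -s⁻¹) ((s ^ 2)⁻¹) s := by
        intro s hs
        rw [uIcc_of_le hs₀1.le] at hs
        have hs0 : s ≠ 0 := (hs₀.trans_le hs.1).ne'
        have h := (hasDerivAt_inv hs0).neg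
        simp only [neg_neg] at h
        exact h
      have hcont' : ContinuousOn (fun s : ℝ => (s ^ 2)⁻¹) (uIcc s₀ 1) := by
        refine (continuousOn_pow 2).inv₀ fun s hs => ?_
        rw [uIcc_of_le hs₀1.le] at hs
        exact pow_ne_zero 2 (hs₀.trans_le hs.1).ne'
      rw [intervalIntegral.integral_eq_sub_of_hasDerivAt hderiv hcont'.intervalIntegrable]
      simp only [inv_one]
      ring
    have hfin : B * c * (s₀⁻¹ - 1) ≤ 2 * B * R * (c * ‖z‖⁻¹) := by
      have hinv : s₀⁻¹ = 2 * R * ‖z‖⁻¹ := by rw [hs₀def, inv_div, div_eq_mul_inv]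
      rw [hinv]
      nlinarith [mul_nonneg hB0 hc, inv_nonneg.2 hzn.le]
    exact hle.trans (heval.le.trans hfin)
  · -- outside the ball: the integrand vanishes
    rw [indicator_of_notMem (by rwa [mem_ball_zero_iff])]
    have hzero : ∫ s in Ioc (0 : ℝ) 1, (s ^ 2)⁻¹ * (Q (s⁻¹ • z) * c) = ∫ s in Ioc (0 : ℝ) 1, (0 : ℝ) := by
      refine setIntegral_congr_fun measurableSet_Ioc fun s hs => ?_
      have hfar : 2 * R ≤ ‖s⁻¹ • z‖ := by
        rw [hnorm s hs.1]
        exact (not_lt.1 hzR).trans (le_div_self (norm_nonneg _) hs.1 hs.2)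
      rw [hQz _ hfar, zero_mul, mul_zero]
    rw [hzero, integral_zero]

/-- **THE KERNEL (NEWTONIAN) FORM OF THE MEAN VALUE DEFECT** on `ℝ³`.  For `0 ≤ Q ≤ B` continuous vanishing off `‖y‖ < 2R` and `f ≥ 0` continuous:
`∫₀¹ s ∫ Q(y) f(x₀ + s y) dy ds ≤ 2BR ∫_{B_{2R}(x₀)} f(z) ‖z − x₀‖⁻¹ dz` (substitution `z = s y`, Tonelli, and the kernel bound `setIntegral_kernel_le`).
[folklore; GilbargTrudinger2001 Thm 2.1 (Green representation)] -/
theorem defect_le_potential (hQ : Continuous Q) (hQ0 : ∀ y, 0 ≤ Q y) (hQB : ∀ y, Q y ≤ B) (hR : 0 < R)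
    (hQz : ∀ y, 2 * R ≤ ‖y‖ → Q y = 0) (hf : Continuous f) (hf0 : ∀ z, 0 ≤ f z) (x₀ : EuclideanSpace ℝ (Fin 3)) :
    ∫ s in (0 : ℝ)..1, s * ∫ y, Q y * f (x₀ + s • y) ≤
      2 * B * R * ∫ z in ball x₀ (2 * R), f z * ‖z - x₀‖⁻¹ := by
  have hB0 : 0 ≤ B := (hQ0 0).trans (hQB 0)
  have hQc : HasCompactSupport Q := hasCompactSupport_of_eq_zero_of_le_norm hQz
  set G : ℝ → ℝ := fun s => ∫ y, Q y * f (x₀ + s • y) with hGdef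
  set g : ℝ → EuclideanSpace ℝ (Fin 3) → ℝ := fun s z => (s ^ 2)⁻¹ * (Q (s⁻¹ • z) * f (x₀ + z)) with hgdef
  have hGc : Continuous G := continuous_integral_mul_comp_add_smul hQ hQc hf x₀
  -- `z ↦ g s z` is integrable for `s > 0`
  have hgi : ∀ s : ℝ, 0 < s → Integrable (g s) := fun s hs => by
    have h1 : Integrable fun z => Q (s⁻¹ • z) * f (x₀ + z) :=
      ((hQ.comp (continuous_const_smul s⁻¹)).mul (hf.comp (continuous_const.add continuous_id))).integrable_of_hasCompactSupport
        ((hQc.comp_smul (inv_ne_zero hs.ne')).mul_right (f' := fun z => f (x₀ + z)))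
    exact h1.const_mul _
  have hg0 : ∀ s z, 0 ≤ g s z := fun s z => mul_nonneg (inv_nonneg.2 (sq_nonneg _)) (mul_nonneg (hQ0 _) (hf0 _))
  -- step 1: the `s`-form as an iterated integral over `(0,1] × ℝ³`
  have hstep1 : (∫ s in (0 : ℝ)..1, s * G s) = ∫ s in Ioc (0 : ℝ) 1, ∫ z, g s z := by
    rw [intervalIntegral.integral_of_le zero_le_one]
    refine setIntegral_congr_fun measurableSet_Ioc fun s hs => ?_
    exact mul_integral_mul_comp_add_smul_eq Q f x₀ hs.1
  -- step 2: Tonelli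
  have hmeas : Measurable (uncurry g) := by
    have h1 : Measurable fun p : ℝ × EuclideanSpace ℝ (Fin 3) => p.1⁻¹ • p.2 := measurable_fst.inv.smul measurable_snd
    have h2 : Measurable fun p : ℝ × EuclideanSpace ℝ (Fin 3) => Q (p.1⁻¹ • p.2) := hQ.measurable.comp h1
    have h3 : Measurable fun p : ℝ × EuclideanSpace ℝ (Fin 3) => f (x₀ + p.2) := hf.measurable.comp (measurable_const.add measurable_snd)
    have h4 : Measurable fun p : ℝ × EuclideanSpace ℝ (Fin 3) => (p.1 ^ 2)⁻¹ := (measurable_fst.pow_const 2).inv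
    exact h4.mul (h2.mul h3)
  have hprod : Integrable (uncurry g) ((volume.restrict (Ioc (0 : ℝ) 1)).prod volume) := by
    refine (integrable_prod_iff hmeas.aestronglyMeasurable).2 ⟨?_, ?_⟩
    · exact (ae_restrict_iff' measurableSet_Ioc).2 (Eventually.of_forall fun s hs => hgi s hs.1)
    · have heq : EqOn (fun s => ∫ z, ‖uncurry g (s, z)‖) (fun s => s * G s) (Ioc (0 : ℝ) 1) := fun s hs => by
        show (∫ z, ‖g s z‖) = s * G s
        rw [mul_integral_mul_comp_add_smul_eq Q f x₀ hs.1]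
        exact integral_congr_ae (Eventually.of_forall fun z => by
          show ‖g s z‖ = g s z
          rw [Real.norm_eq_abs, abs_of_nonneg (hg0 s z)])
      refine (IntegrableOn.congr_fun ?_ heq.symm measurableSet_Ioc)
      exact ((continuous_id.mul hGc).integrableOn_Icc (a := 0) (b := 1)).mono_set Ioc_subset_Icc_self
  have hstep2 : (∫ s in Ioc (0 : ℝ) 1, ∫ z, g s z) = ∫ z, ∫ s in Ioc (0 : ℝ) 1, g s z :=
    integral_integral_swap hprod
  -- step 3: the kernel bound, pointwise in `z ≠ 0`
  set k : EuclideanSpace ℝ (Fin 3) → ℝ :=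
    (ball (0 : EuclideanSpace ℝ (Fin 3)) (2 * R)).indicator fun z => 2 * B * R * (f (x₀ + z) * ‖z‖⁻¹) with hkdef
  have hki : Integrable k := by
    have h1 : IntegrableOn (fun z => f (x₀ + z) * ‖z - 0‖⁻¹) (ball (0 : EuclideanSpace ℝ (Fin 3)) (2 * R)) :=
      integrableOn_mul_inv_norm_sub_ball (hf.comp (continuous_const.add continuous_id)) 0 0 (2 * R)
    simp only [sub_zero] at h1
    have h2 : IntegrableOn (fun z => 2 * B * R * (f (x₀ + z) * ‖z‖⁻¹)) (ball (0 : EuclideanSpace ℝ (Fin 3)) (2 * R)) :=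
      h1.const_mul (2 * B * R)
    exact h2.integrable_indicator measurableSet_ball
  have hle : (∫ z, ∫ s in Ioc (0 : ℝ) 1, g s z) ≤ ∫ z, k z := by
    refine integral_mono_of_nonneg (Eventually.of_forall fun z => integral_nonneg fun s => hg0 s z) hki ?_
    have hae : ∀ᵐ z : EuclideanSpace ℝ (Fin 3) ∂volume, z ≠ 0 := by
      have : ({0} : Set (EuclideanSpace ℝ (Fin 3)))ᶜ ∈ ae (volume : Measure (EuclideanSpace ℝ (Fin 3))) :=
        compl_mem_ae_iff.2 (measure_singleton 0)
      filter_upwards [this] with z hz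
      simpa using hz
    filter_upwards [hae] with z hz
    exact setIntegral_kernel_le hQ0 hQB hR hQz hz (hf0 (x₀ + z))
  -- step 4: evaluate `∫ k`
  have hk_eval : (∫ z, k z) = 2 * B * R * ∫ z in ball x₀ (2 * R), f z * ‖z - x₀‖⁻¹ := by
    rw [hkdef, integral_indicator measurableSet_ball, integral_const_mul,
      ← setIntegral_ball_comp_add (fun z => f z * ‖z - x₀‖⁻¹) x₀ (2 * R)]
    simp
  calc (∫ s in (0 : ℝ)..1, s * G s) = ∫ s in Ioc (0 : ℝ) 1, ∫ z, g s z := hstep1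
    _ = ∫ z, ∫ s in Ioc (0 : ℝ) 1, g s z := hstep2
    _ ≤ ∫ z, k z := hle
    _ = 2 * B * R * ∫ z in ball x₀ (2 * R), f z * ‖z - x₀‖⁻¹ := hk_eval

end Kernel

/-! ### Profiles: the pressure excess is carried by the Newtonian potential of the enstrophy -/

/-- **THE PRESSURE EXCESS OF A PROFILE IS CARRIED BY THE NEWTONIAN POTENTIAL OF THE ENSTROPHY.**  Let `(V, P′)` be a `C²` self-similar Euler
profile on `ℝ³` (any `γ`, any centre), `x₀ ∈ ℝ³`, `R > 0`.  Then
`P′(x₀) ≤ ∫ χ_R(y) P′(x₀ + y) dy + (12/m) ∫_{B_{2R}(x₀)} ‖DV(z)‖² ‖z − x₀‖⁻¹ dz`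
(`χ_R = probeBump R`, `m = baseBumpMass ℝ³`; `ΔP′ ≥ −3‖DV‖²`, sub-mean-value inequality with defect, kernel form). [folklore; GilbargTrudinger2001 Thm 2.1] -/
theorem pressure_excess_le_potential {γ : ℝ} {c : EuclideanSpace ℝ (Fin 3)}
    {V : EuclideanSpace ℝ (Fin 3) → EuclideanSpace ℝ (Fin 3)} {P' : EuclideanSpace ℝ (Fin 3) → ℝ}
    (hprof : IsSelfSimilarEulerProfile γ c V P') (x₀ : EuclideanSpace ℝ (Fin 3)) {R : ℝ} (hR : 0 < R) :
    P' x₀ ≤ (∫ y, probeBump R y * P' (x₀ + y)) +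
      12 / baseBumpMass (EuclideanSpace ℝ (Fin 3)) * ∫ z in ball x₀ (2 * R), ‖fderiv ℝ V z‖ ^ 2 * ‖z - x₀‖⁻¹ := by
  have hm : 0 < baseBumpMass (EuclideanSpace ℝ (Fin 3)) := baseBumpMass_pos
  set f : EuclideanSpace ℝ (Fin 3) → ℝ := fun z => 3 * ‖fderiv ℝ V z‖ ^ 2 with hfdef
  have hDVc : Continuous fun z => ‖fderiv ℝ V z‖ ^ 2 :=
    (hprof.contDiff_velocity.continuous_fderiv (by simp)).norm.pow 2
  have hf : Continuous f := continuous_const.mul hDVc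
  have hf0 : ∀ z, 0 ≤ f z := fun z => by positivity
  have hΔ : ∀ x, -f x ≤ (Δ P') x := fun x => by
    simpa [hfdef] using hprof.neg_three_mul_sq_opNorm_fderiv_le_laplacian_pressure x
  obtain ⟨Q, hQ, hQ0, hQz, hQB, hmv⟩ :=
    le_integral_probeBump_mul_comp_add_add hprof.contDiff_two_pressure hf hΔ hR
  rw [finrank_euclideanSpace_fin] at hQB
  have hD := defect_le_potential hQ hQ0 hQB hR hQz hf hf0 x₀
  have hI : (∫ z in ball x₀ (2 * R), f z * ‖z - x₀‖⁻¹) = 3 * ∫ z in ball x₀ (2 * R), ‖fderiv ℝ V z‖ ^ 2 * ‖z - x₀‖⁻¹ := by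
    rw [← integral_const_mul]
    exact integral_congr_ae (Eventually.of_forall fun z => by simp only [hfdef]; ring)
  rw [hI] at hD
  have halg : 2 * (2 * R ^ 2 * (baseBumpMass (EuclideanSpace ℝ (Fin 3)) * R ^ 3)⁻¹) * R *
      (3 * ∫ z in ball x₀ (2 * R), ‖fderiv ℝ V z‖ ^ 2 * ‖z - x₀‖⁻¹) =
      12 / baseBumpMass (EuclideanSpace ℝ (Fin 3)) * ∫ z in ball x₀ (2 * R), ‖fderiv ℝ V z‖ ^ 2 * ‖z - x₀‖⁻¹ := by
    field_simp
    ring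
  linarith [hmv x₀]

end Summit.NavierStokesRegularity.NavierStokesRegularity.Theorems.PowerGaugeEulerLiouville.PressureParking

end
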